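import Summits.QuantumFields.YangMills.Theorems.BalabanUVNodesN22WindowedSecondDiffOutputLevel
import Summits.QuantumFields.YangMills.Theorems.BalabanUVNodesN22UniformDecayOutputLevel
import Summits.QuantumFields.YangMills.Theorems.BalabanUVNodesN18KingModelOneRun
import Summits.QuantumFields.YangMills.Theorems.BalabanUVNodesN18KernelStepRateKingMechanism

/-!
# BalabanUVNodes ∕ node N22 = NE9 — K3⁷ v5 §2b's `h9` WITH THE RECORD's GEOMETRIC MODULI AT THE RECORD, END TO END IN OUTPUT-LEVEL CURRENCY: node N18's kernel step rate
# of record + the uniform kernel decay + OUTPUT-LEVEL COUPLING MARGINS WITH ONE RADIUS (through the readings of record, W1-20's law and the (1.21) existence) — the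
# junction J39 ∘ W1-20 ∘ J38 («J38 at the record»)

Cell `pub-ymgap`, HUMAN RULING D-0062 (Track A), R134 seat `pub-ymgap-dag-n22-c` (strategy s1), generation 14, module J40.  THEOREMS ONLY (no `def`, no `sorry`, standard axioms);
`--kind proof --supports stmt-QuantumFields-20544 --as helper` (K3⁷ `SpineGivenEndpointR13SepCoPH`, skeleton v5 941dddb108cb), COUNT-NEUTRAL.  Imports J39
`…Theorems.BalabanUVNodesN22WindowedSecondDiffOutputLevel` (through it J38 `…N22KernelFadingOfStepRate`, J36, node00-def-W1's W1-19∕W1-20∕W1-21) and J41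
`…Theorems.BalabanUVNodesN22UniformDecayOutputLevel` (the uniform kernel decay of record from the margin datum).  Nothing re-declared; every step is plain application.

WHAT.  (Rate monotonicity of the two kernel letters BY NAME: dag-n18 lanes' `kernelStepRate_mono` ∕ `decayBound_mono`.)  §1 ★ `kernelSecondDiff_objectsOfRecord₁₃_of_outputCoordHolo` — the kernel
second-difference letter (R₂) AT THE KERNEL FUNCTIONAL OF RECORD from J39's windowed letter at the W1 reading `localizedSum F S emb`, W1-20's law `Localizes17OfRecord₁₃ F N θ S emb`
(`polWindow_eventuallyEq_of_eventuallyAgree` at the three updated histories) and `PolLimitsExistOfRecord₁₃` (J38 §3 `kernelSecondDiff_of_windowed`).  §2 ★★★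
`ne9_EA_objectsOfRecord₁₃_of_kernelStepRate_outputCoordHolo` — v5 §2b's `h9 : NE9 ((objectsOfRecord₁₃ F N θ ℓ).EA 0) (Window θ.γ) ℓ.κ ℓ.moduli` from: node N18's
`KernelStepRateOfRecord₁₃ F N θ κ₅ ℓ.θ₅ C₅`; the uniform kernel decay `DecayBound ((objectsOfRecord₁₃ …).EA 0) (Window θ.γ) E₀ κ_d` ((D4)'s letter in its printed, uniform type);
J39's OUTPUT-LEVEL inputs (margin datum `hL` with ONE radius `ρ₀`, term holomorphy through the readings of record, chart∕space clauses, site-weight tails); W1-20's law; (1.21)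
existence; the letter rows `δ₁ ≤ κ₅`, `δ₁ ≤ κ_d`, `0 < ℓ.ω`, `ℓ.θ₅ ≤ ℓ.ω²`, `ℓ.κ ≤ δ₁`, `(4C₀∕γ + C₂γ∕2)∕ℓ.ω ≤ ℓ.C₉` (`C₀ = 2C₅∕(1−θ₅) + 2E₀`, `C₂` = J39's constant,
`δ₁ = ½min{δ₀, κ(4M)⁻¹}`) — J38 §2 ∘ §1; and the pin face `n22At_rateCarriers_of_kernels_pin_of_kernelStepRate_outputCoordHolo`.  §2′ ★★★ `…_outputCoordHolo'` — the SAME with the uniform decay letter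
DISCHARGED from the margin datum itself (module J41 `…N22UniformDecayOutputLevel.decayBound_objectsOfRecord₁₃_of_outputCoordHolo`): N18's letter + `hL` + readings∕tails∕law∕(1.21) + rows.
THE N22 ROW SENTENCE in this currency: «N18's kernel step rate + (1.18)∕(5.10) uniform decay + output-level coupling margins with ONE radius + W1-20's law + (1.21) + rows ⇒ v5
§2b `h9` ∕ `N22At` with the record's GEOMETRIC moduli» — NO age-growing radii, NO activity slot, NO uniform-table domination, NO `StepLipschitz` smallness.

HONEST FRAMING (binding).  Count-neutral COMPOSITION; NO estimate of Bałaban's is proved or asserted; every displayed input is a HYPOTHESIS with its owner (node N18; the (D4) road ∕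
N09 ∕ N10 ∕ NODE A for the uniform decay and the output-level margins; NODE A ∕ def-W1 for the readings, tails and the law; dag-n22-w3's road for (1.21)); nothing of the record is
constructed or claimed to meet them; N22 is NOT discharged (typed 28∕28 · discharged 5∕27 UNCHANGED); K3⁷ OPEN and NOT claimed; NE9 is NOT IN PRINT for d = 4; no count claim; one finite
𝕋⁴ programme at fixed ε — R4 closes the CONDITIONAL rung `BalabanLadder.UV` only; NOTHING about the continuum limit, ℝ⁴, infinite volume, OS axioms, a mass gap or the Clay problem is
proved or claimed.  References (TYPES only, no cite tags on the Summit side): [I] = Bałaban, CMP 109 (1987) Thm 1 p. 259, (1.7) p. 261, (1.18) p. 263, (1.20)–(1.22) p. 264, §2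
p. 266, p. 282 (site-weight tails: the sentence after (4.4)), (4.35)–(4.37) pp. 290–291, (5.10) p. 293; [II] = CMP 116 (1988) (2.13)–(2.14) pp. 14–15.
-/

noncomputable section

open Filter Topology Set Metric
open scoped BigOperators

namespace YMDAG.N22.KernelFading

open Literature.MathematicalPhysics.QuantumFieldTheory.Balaban1983to89
open Literature.MathematicalPhysics.QuantumFieldTheory.Balaban1983to89.T4Continuum (T4Family ULoop)
open Literature.MathematicalPhysics.QuantumFieldTheory.Balaban1983to89.T4OutputRate (Carriers Functional Window NE9 DecayBound)
open Literature.MathematicalPhysics.QuantumFieldTheory.Balaban1983to89.TreeLengthTorus (TPt)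
open Literature.MathematicalPhysics.QuantumFieldTheory.Balaban1983to89.B12TreeDecay (K₀ kappa₀ K₀_pos)
open Literature.MathematicalPhysics.QuantumFieldTheory.Balaban1983to89.B12Decay510 (delta1)
open Literature.MathematicalPhysics.QuantumFieldTheory.Balaban1983to89.B12Decay510Window (K₁ K₁_nonneg)
open Literature.MathematicalPhysics.QuantumFieldTheory.Balaban1983to89.B12Decay510Torus (distCT nearT)
open Literature.MathematicalPhysics.QuantumFieldTheory.Balaban1983to89.B12Sec2to5 (l1)
open Literature.MathematicalPhysics.QuantumFieldTheory.Balaban1983to89.Node00 (TermFamily1 polWindow PolLimitExists mergedTermFamilyMatT TβOfRecord₁₃ chiβOfRecord₁₃ Stage13Params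
  Stage13HParams U3Letters₁₁ MatA)
open Literature.MathematicalPhysics.QuantumFieldTheory.Balaban1983to89.Node00.Sect2 (domSys domCount CPair)
open Literature.MathematicalPhysics.QuantumFieldTheory.Balaban1983to89.Node00.W1
open Literature.MathematicalPhysics.QuantumFieldTheory.Balaban1983to89.Node00.LocalizedSum17 (localizedSum ReadingMaps Localizes17OfRecord₁₃)
open Literature.MathematicalPhysics.QuantumFieldTheory.Balaban1983to89.Node00.U3OfKernels (carriers histPrefix kernelA EA objectsOfRecord₁₃ EA_apply kernelA_eq)
open Literature.MathematicalPhysics.QuantumFieldTheory.Balaban1983to89.Node00.U3KernelLetters (KernelStepRate KernelStepRateOfRecord₁₃ PolLimitsExistOfRecord₁₃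
  polLimitsExistOfRecord₁₃_iff polWindow_eventuallyEq_of_eventuallyAgree)
open YMDAG.N22.UniformDecay (decayBound_objectsOfRecord₁₃_of_outputCoordHolo)
open Summit.QuantumFields.YangMills.BalabanUVNodes.N18KingModelOneRun (decayBound_mono)
open YMDAG.N18.KernelStepRateKingMechanism (kernelStepRate_mono)
open YMDAG.UVSplit (N22At RateReading₁₃CoPH rateCarriersOfRecord₁₃CoPH)
open YMDAG.N22.AtKernels (n22At_rateCarriers_of_kernels_pin_of_ne9)
open YMDAG.N22.WindowedSecondDiff (windowedSecondDiff_localizedSum_of_outputCoordHolo)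

open scoped Matrix.Norms.L2Operator

/-! ## §1 The kernel second-difference letter (R₂) AT THE RECORD from J39's windowed letter, W1-20's law and (1.21) -/

section Record

variable (F : T4Family) (N : ℕ) [NeZero N] {𝔸 : Type*} {M : ℕ}

open Classical in
/-- ★ **(R₂) AT THE KERNEL FUNCTIONAL OF RECORD FROM OUTPUT-LEVEL MARGINS WITH ONE RADIUS.**  Towers `S K` read through `emb : ReadingMaps F (MatA N) 𝔸` with W1-20's law
`Localizes17OfRecord₁₃ F N θ S emb`; J39's inputs at the chart of record `θ.ρ8 ∕ θ.bV` (margin datum `hL` with radius `ρ₀`, term holomorphy through the readings for every window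
history, chart∕space clauses, site-weight tails; `M = L^{m′}`); `PolLimitsExistOfRecord₁₃ F N θ` ⟹ the second differences of the limiting kernels of record in every young coupling on
`]0, θ.γ]` are `≤ C₂·e^{−δ₁|z|₁}·d²` (J39's constant and rate) — J39 + `polWindow_eventuallyEq_of_eventuallyAgree` (three histories) + J38 §3. [folklore] -/
theorem kernelSecondDiff_objectsOfRecord₁₃_of_outputCoordHolo (θ : Stage13Params F N) (ℓ : U3Letters₁₁) (hlim : PolLimitsExistOfRecord₁₃ F N θ)
    (m' : ℕ) (M : ℕ) [NeZero M] (hM : M = F.L ^ m')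
    (S : (K : ℕ) → ClusterTower (F.P K) 𝔸 M) (emb : ReadingMaps F (MatA N) 𝔸) (hloc : Localizes17OfRecord₁₃ F N θ S emb)
    (sp : (K k : ℕ) → (domSys (F.P K) M (k + 1)).Dom → Set (CPair (F.P K) 𝔸))
    {κ κE δ₀ B₃ r B ρ₀ : ℝ} (hρ₀ : 0 < ρ₀)
    (hκ₀ : kappa₀ (4 * 2 ^ 4) (2 * 4) ≤ κ / 2) (hδ₀ : 0 < δ₀) (hB₃ : 0 ≤ B₃) (hr : 0 < r) (hB : 0 ≤ B) (hκE : κ ≤ κE)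
    (hL : ∀ (K k : ℕ) (i : Fin (k + 1)), ∀ g ∈ box θ.γ k, ∀ (X : (domSys (F.P K) M (k + 1)).Dom), ∀ φ ∈ sp K k X,
      ∃ (Ec : ℂ → ℂ) (O : Set ℂ), DifferentiableOn ℂ Ec O ∧ (∀ t ∈ Ioc (0 : ℝ) θ.γ, closedBall (t : ℂ) ρ₀ ⊆ O) ∧
        (∀ z ∈ O, ‖Ec z‖ ≤ B * Real.exp (-(κE * (domSys (F.P K) M (k + 1)).dj X))) ∧
        (∀ t ∈ Ioc (0 : ℝ) θ.γ, Ec t = ((S K) k).E (Function.update g i t) φ X))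
    (Ec : ℕ → ℕ → Type*) [∀ K k, NormedAddCommGroup (Ec K k)] [∀ K k, NormedSpace ℂ (Ec K k)]
    (ι : letI := θ.instVβ₁; letI := θ.instVβ₂
      (K k : ℕ) → (domSys (F.P K) M (k + 1)).Dom → ((Fin (F.P K).d → Site (F.P K) (k + 1) → θ.Vβ) →L[ℝ] Ec K k))
    (Φ : (K k : ℕ) → (domSys (F.P K) M (k + 1)).Dom → Ec K k → CPair (F.P K) 𝔸)
    (U : (K k : ℕ) → (domSys (F.P K) M (k + 1)).Dom → Set (Ec K k)) (hU : ∀ K k X, IsOpen (U K k X)) (hrU : ∀ K k X, ball (0 : Ec K k) r ⊆ U K k X)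
    (hEhol : ∀ g ∈ Window θ.γ, ∀ (K k : ℕ) (X : (domSys (F.P K) M (k + 1)).Dom),
      DifferentiableOn ℂ (fun z => ((S K) k).E (histPrefix g k) (Φ K k X z) X) (U K k X))
    (hΦemb : letI := θ.instVβ₁; letI := θ.instVβ₂
      ∀ (K k : ℕ) (X : (domSys (F.P K) M (k + 1)).Dom) (Bf : Fin (F.P K).d → Site (F.P K) (k + 1) → θ.Vβ),
        Φ K k X (ι K k X Bf) = emb K k (fun l t => NormedSpace.exp (θ.ρ8 (Bf l t))))
    (hΦsp : ∀ (K k : ℕ) (X : (domSys (F.P K) M (k + 1)).Dom), ∀ z ∈ ball (0 : Ec K k) r, Φ K k X z ∈ sp K k X)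
    (w : (K k : ℕ) → (domSys (F.P K) M (k + 1)).Dom → Site (F.P K) (k + 1) → ℝ) (hw₀ : ∀ K k X t, 0 ≤ w K k X t)
    (hw : letI := θ.instVβ₁; letI := θ.instVβ₂; letI := θ.instιβ
      ∀ (K k : ℕ) (X : (domSys (F.P K) M (k + 1)).Dom) (l : Fin (F.P K).d) (t : Site (F.P K) (k + 1)) (c : θ.ιβ),
        ‖ι K k X (Pi.single l (Pi.single t (θ.bV c)))‖ ≤ w K k X t)
    (htail : ∀ (K k : ℕ) (X : (domSys (F.P K) M (k + 1)).Dom) (t : Site (F.P K) (k + 1)),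
      let e : Site (F.P K) (k + 1) → TPt 4 (domCount (F.P K) M (k + 1) * M) := fun x i => (ZMod.cast (x i) : ZMod (domCount (F.P K) M (k + 1) * M))
      w K k X t ≤ B₃ * Real.exp (-δ₀ * distCT (domCount (F.P K) M (k + 1)) M (e t) (nearT (M := M) (e t) X))) :
    ∀ g ∈ Window θ.γ, ∀ (Uu : PUnit) (X : ((objectsOfRecord₁₃ F N θ ℓ).levelCarriers 0).Dom) (i : ℕ),
      i < ((objectsOfRecord₁₃ F N θ ℓ).levelCarriers 0).scale X → ∀ t d : ℝ, 0 < d → t - d ∈ Ioc (0 : ℝ) θ.γ → t + d ∈ Ioc (0 : ℝ) θ.γ →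
        |(objectsOfRecord₁₃ F N θ ℓ).EA 0 (Function.update g i (t + d)) Uu X - 2 * (objectsOfRecord₁₃ F N θ ℓ).EA 0 (Function.update g i t) Uu X +
            (objectsOfRecord₁₃ F N θ ℓ).EA 0 (Function.update g i (t - d)) Uu X| ≤
          (16 * (64 * B / ρ₀ ^ 2) * B₃ ^ 2 / r ^ 2) * Real.exp (delta1 δ₀ κ ((M : ℝ) * 4) * ((M : ℝ) * 4) * 3) * K₀ (4 * 2 ^ 4) (2 * 4) * K₁ 4 (δ₀ / 2) *
            Real.exp (-(delta1 δ₀ κ ((M : ℝ) * 4) * ((objectsOfRecord₁₃ F N θ ℓ).levelCarriers 0).d X)) * d ^ 2 := by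
  letI := θ.instVβ₁; letI := θ.instVβ₂; letI := θ.instιβ
  intro g hg Uu X i hi t d hd hm hp
  obtain ⟨k, μ, ν, z⟩ := X
  -- J39 at the reading
  have hW := windowedSecondDiff_localizedSum_of_outputCoordHolo F m' M hM S emb θ.ρ8 θ.bV sp hρ₀ hκ₀ hδ₀ hB₃ hr hB hκE hL Ec ι Φ U hU hrU hEhol hΦemb hΦsp
    w hw₀ hw htail g hg k μ ν z i hi t d hd hm hp
  -- transfer to the merged term family of record by W1-20's law, at the three updated histories
  have hA := hloc.eventuallyAgree F
  have ep := polWindow_eventuallyEq_of_eventuallyAgree F θ.ρ8 θ.bV hA (Function.update g i (t + d)) k μ ν z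
  have e0 := polWindow_eventuallyEq_of_eventuallyAgree F θ.ρ8 θ.bV hA (Function.update g i t) k μ ν z
  have em := polWindow_eventuallyEq_of_eventuallyAgree F θ.ρ8 θ.bV hA (Function.update g i (t - d)) k μ ν z
  have hW' : ∀ᶠ K in atTop,
      |polWindow F K (k + 1) (mergedTermFamilyMatT F N (TβOfRecord₁₃ F N) (chiβOfRecord₁₃ F N θ) θ.εbg k (histPrefix (Function.update g i (t + d)) k) K) θ.ρ8 θ.bV μ ν z -
          2 * polWindow F K (k + 1) (mergedTermFamilyMatT F N (TβOfRecord₁₃ F N) (chiβOfRecord₁₃ F N θ) θ.εbg k (histPrefix (Function.update g i t) k) K) θ.ρ8 θ.bV μ ν z +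
          polWindow F K (k + 1) (mergedTermFamilyMatT F N (TβOfRecord₁₃ F N) (chiβOfRecord₁₃ F N θ) θ.εbg k (histPrefix (Function.update g i (t - d)) k) K) θ.ρ8 θ.bV μ ν z| ≤
        (16 * (64 * B / ρ₀ ^ 2) * B₃ ^ 2 / r ^ 2) * Real.exp (delta1 δ₀ κ ((M : ℝ) * 4) * ((M : ℝ) * 4) * 3) * K₀ (4 * 2 ^ 4) (2 * 4) * K₁ 4 (δ₀ / 2) * d ^ 2 *
          Real.exp (-(delta1 δ₀ κ ((M : ℝ) * 4) * l1 z)) := by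
    filter_upwards [hW, ep, e0, em] with K hK hKp hK0 hKm
    rw [hKp, hK0, hKm]; exact hK
  -- (1.21) passage at the three histories (J38 §3's one-entry tool)
  have ht : t ∈ Ioc (0 : ℝ) θ.γ := ⟨by linarith [hm.1], by linarith [hp.2]⟩
  have hl := (polLimitsExistOfRecord₁₃_iff F N θ).1 hlim
  show |kernelA F (mergedTermFamilyMatT F N (TβOfRecord₁₃ F N) (chiβOfRecord₁₃ F N θ) θ.εbg) θ.ρ8 θ.bV (Function.update g i (t + d)) k μ ν z -
      2 * kernelA F (mergedTermFamilyMatT F N (TβOfRecord₁₃ F N) (chiβOfRecord₁₃ F N θ) θ.εbg) θ.ρ8 θ.bV (Function.update g i t) k μ ν z +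
      kernelA F (mergedTermFamilyMatT F N (TβOfRecord₁₃ F N) (chiβOfRecord₁₃ F N θ) θ.εbg) θ.ρ8 θ.bV (Function.update g i (t - d)) k μ ν z| ≤
    (16 * (64 * B / ρ₀ ^ 2) * B₃ ^ 2 / r ^ 2) * Real.exp (delta1 δ₀ κ ((M : ℝ) * 4) * ((M : ℝ) * 4) * 3) * K₀ (4 * 2 ^ 4) (2 * 4) * K₁ 4 (δ₀ / 2) *
      Real.exp (-(delta1 δ₀ κ ((M : ℝ) * 4) * l1 z)) * d ^ 2
  rw [kernelA_eq, kernelA_eq, kernelA_eq]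
  refine (abs_secondDiff_le_of_tendsto
    (Node00.tendsto_polLimit F (k + 1) _ θ.ρ8 θ.bV (hl _ (update_mem_window hg i hp) k) μ ν z)
    (Node00.tendsto_polLimit F (k + 1) _ θ.ρ8 θ.bV (hl _ (update_mem_window hg i ht) k) μ ν z)
    (Node00.tendsto_polLimit F (k + 1) _ θ.ρ8 θ.bV (hl _ (update_mem_window hg i hm) k) μ ν z) hW').trans (le_of_eq ?_)
  ring

open Classical in
/-- ★★★ **K3⁷ v5 §2b's `h9` WITH THE RECORD's GEOMETRIC MODULI, END TO END IN OUTPUT-LEVEL CURRENCY («J38 at the record»).**  At a Stage-13 parameter tuple `θ` (`0 < θ.γ`) with a letter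
block `ℓ` (`ℓ.Signs`): node N18's `KernelStepRateOfRecord₁₃ F N θ κ₅ ℓ.θ₅ C₅`; the uniform kernel decay `DecayBound ((objectsOfRecord₁₃ F N θ ℓ).EA 0) (Window θ.γ) E₀ κ_d`; §1's
OUTPUT-LEVEL inputs (margins with ONE radius `ρ₀`, readings of record, tails, W1-20's law, (1.21)); the rows `δ₁ ≤ κ₅`, `δ₁ ≤ κ_d`, `0 < ℓ.ω`, `ℓ.θ₅ ≤ ℓ.ω²`, `ℓ.κ ≤ δ₁`,
`(4·(2C₅∕(1−ℓ.θ₅) + 2E₀)∕θ.γ + C₂·θ.γ∕2)∕ℓ.ω ≤ ℓ.C₉` (`δ₁ = ½min{δ₀, κ(4M)⁻¹}`, `C₂` = J39's constant) ⟹ **`NE9 ((objectsOfRecord₁₃ F N θ ℓ).EA 0) (Window θ.γ) ℓ.κ ℓ.moduli`**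
— §1 + J38 §2 (rates lowered to `δ₁` by `kernelStepRate_mono` ∕ `decayBound_mono`).  LOCATED (hypothesis form); N22 NOT discharged. [folklore] -/
theorem ne9_EA_objectsOfRecord₁₃_of_kernelStepRate_outputCoordHolo (θ : Stage13Params F N) (ℓ : U3Letters₁₁) (hs : ℓ.Signs) (hγ : 0 < θ.γ)
    (hlim : PolLimitsExistOfRecord₁₃ F N θ) {κ₅ κd C₅ E₀ : ℝ} (hC₅ : 0 ≤ C₅) (hE₀ : 0 ≤ E₀)
    (h5 : KernelStepRateOfRecord₁₃ F N θ κ₅ ℓ.θ₅ C₅) (hdec : DecayBound ((objectsOfRecord₁₃ F N θ ℓ).EA 0) (Window θ.γ) E₀ κd)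
    (m' : ℕ) (M : ℕ) [NeZero M] (hM : M = F.L ^ m')
    (S : (K : ℕ) → ClusterTower (F.P K) 𝔸 M) (emb : ReadingMaps F (MatA N) 𝔸) (hloc : Localizes17OfRecord₁₃ F N θ S emb)
    (sp : (K k : ℕ) → (domSys (F.P K) M (k + 1)).Dom → Set (CPair (F.P K) 𝔸))
    {κ κE δ₀ B₃ r B ρ₀ : ℝ} (hρ₀ : 0 < ρ₀)
    (hκ₀ : kappa₀ (4 * 2 ^ 4) (2 * 4) ≤ κ / 2) (hδ₀ : 0 < δ₀) (hB₃ : 0 ≤ B₃) (hr : 0 < r) (hB : 0 ≤ B) (hκE : κ ≤ κE)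
    (hL : ∀ (K k : ℕ) (i : Fin (k + 1)), ∀ g ∈ box θ.γ k, ∀ (X : (domSys (F.P K) M (k + 1)).Dom), ∀ φ ∈ sp K k X,
      ∃ (Ec : ℂ → ℂ) (O : Set ℂ), DifferentiableOn ℂ Ec O ∧ (∀ t ∈ Ioc (0 : ℝ) θ.γ, closedBall (t : ℂ) ρ₀ ⊆ O) ∧
        (∀ z ∈ O, ‖Ec z‖ ≤ B * Real.exp (-(κE * (domSys (F.P K) M (k + 1)).dj X))) ∧
        (∀ t ∈ Ioc (0 : ℝ) θ.γ, Ec t = ((S K) k).E (Function.update g i t) φ X))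
    (Ec : ℕ → ℕ → Type*) [∀ K k, NormedAddCommGroup (Ec K k)] [∀ K k, NormedSpace ℂ (Ec K k)]
    (ι : letI := θ.instVβ₁; letI := θ.instVβ₂
      (K k : ℕ) → (domSys (F.P K) M (k + 1)).Dom → ((Fin (F.P K).d → Site (F.P K) (k + 1) → θ.Vβ) →L[ℝ] Ec K k))
    (Φ : (K k : ℕ) → (domSys (F.P K) M (k + 1)).Dom → Ec K k → CPair (F.P K) 𝔸)
    (U : (K k : ℕ) → (domSys (F.P K) M (k + 1)).Dom → Set (Ec K k)) (hU : ∀ K k X, IsOpen (U K k X)) (hrU : ∀ K k X, ball (0 : Ec K k) r ⊆ U K k X)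
    (hEhol : ∀ g ∈ Window θ.γ, ∀ (K k : ℕ) (X : (domSys (F.P K) M (k + 1)).Dom),
      DifferentiableOn ℂ (fun z => ((S K) k).E (histPrefix g k) (Φ K k X z) X) (U K k X))
    (hΦemb : letI := θ.instVβ₁; letI := θ.instVβ₂
      ∀ (K k : ℕ) (X : (domSys (F.P K) M (k + 1)).Dom) (Bf : Fin (F.P K).d → Site (F.P K) (k + 1) → θ.Vβ),
        Φ K k X (ι K k X Bf) = emb K k (fun l t => NormedSpace.exp (θ.ρ8 (Bf l t))))
    (hΦsp : ∀ (K k : ℕ) (X : (domSys (F.P K) M (k + 1)).Dom), ∀ z ∈ ball (0 : Ec K k) r, Φ K k X z ∈ sp K k X)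
    (w : (K k : ℕ) → (domSys (F.P K) M (k + 1)).Dom → Site (F.P K) (k + 1) → ℝ) (hw₀ : ∀ K k X t, 0 ≤ w K k X t)
    (hw : letI := θ.instVβ₁; letI := θ.instVβ₂; letI := θ.instιβ
      ∀ (K k : ℕ) (X : (domSys (F.P K) M (k + 1)).Dom) (l : Fin (F.P K).d) (t : Site (F.P K) (k + 1)) (c : θ.ιβ),
        ‖ι K k X (Pi.single l (Pi.single t (θ.bV c)))‖ ≤ w K k X t)
    (htail : ∀ (K k : ℕ) (X : (domSys (F.P K) M (k + 1)).Dom) (t : Site (F.P K) (k + 1)),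
      let e : Site (F.P K) (k + 1) → TPt 4 (domCount (F.P K) M (k + 1) * M) := fun x i => (ZMod.cast (x i) : ZMod (domCount (F.P K) M (k + 1) * M))
      w K k X t ≤ B₃ * Real.exp (-δ₀ * distCT (domCount (F.P K) M (k + 1)) M (e t) (nearT (M := M) (e t) X)))
    (hκ₅ : delta1 δ₀ κ ((M : ℝ) * 4) ≤ κ₅) (hκd : delta1 δ₀ κ ((M : ℝ) * 4) ≤ κd)
    (hω : 0 < ℓ.ω) (hθω : ℓ.θ₅ ≤ ℓ.ω ^ 2) (hℓκ : ℓ.κ ≤ delta1 δ₀ κ ((M : ℝ) * 4))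
    (hC₉ : (4 * (2 * C₅ / (1 - ℓ.θ₅) + 2 * E₀) / θ.γ +
        ((16 * (64 * B / ρ₀ ^ 2) * B₃ ^ 2 / r ^ 2) * Real.exp (delta1 δ₀ κ ((M : ℝ) * 4) * ((M : ℝ) * 4) * 3) * K₀ (4 * 2 ^ 4) (2 * 4) *
          K₁ 4 (δ₀ / 2)) * θ.γ / 2) / ℓ.ω ≤ ℓ.C₉) :
    NE9 ((objectsOfRecord₁₃ F N θ ℓ).EA 0) (Window θ.γ) ℓ.κ ℓ.moduli := by
  have hK : 0 < K₀ (4 * 2 ^ 4) (2 * 4) := K₀_pos _ _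
  have hM₂ : (0 : ℝ) ≤ (16 * (64 * B / ρ₀ ^ 2) * B₃ ^ 2 / r ^ 2) * Real.exp (delta1 δ₀ κ ((M : ℝ) * 4) * ((M : ℝ) * 4) * 3) * K₀ (4 * 2 ^ 4) (2 * 4) *
      K₁ 4 (δ₀ / 2) := by have := K₁_nonneg 4 (δ₀ / 2); positivity
  have h5' : KernelStepRateOfRecord₁₃ F N θ (delta1 δ₀ κ ((M : ℝ) * 4)) ℓ.θ₅ C₅ := by
    letI := θ.instVβ₁; letI := θ.instVβ₂; letI := θ.instιβ
    exact kernelStepRate_mono F θ.ρ8 θ.bV h5 le_rfl hκ₅ hs.θ₅_pos.le le_rfl le_rfl hC₅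
  exact ne9_EA_objectsOfRecord₁₃_of_kernelStepRate_secondDiff F N θ ℓ hs hγ hC₅ hE₀ hM₂ h5' (decayBound_mono hdec subset_rfl hκd le_rfl)
    (kernelSecondDiff_objectsOfRecord₁₃_of_outputCoordHolo F N θ ℓ hlim m' M hM S emb hloc sp hρ₀ hκ₀ hδ₀ hB₃ hr hB hκE hL Ec ι Φ U hU hrU hEhol hΦemb hΦsp
      w hw₀ hw htail) hω hθω hℓκ hC₉

open Classical in
/-- ★★★ **THE N22 PIN FACE, END TO END IN OUTPUT-LEVEL CURRENCY**: under K3⁷ v5's node-U3 pin at the tuple (`hpin`), the inputs of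
`ne9_EA_objectsOfRecord₁₃_of_kernelStepRate_outputCoordHolo` at `θ.toStage13Params` give `N22At (rateCarriersOfRecord₁₃CoPH 𝔯 F θ hP g₀ os k).u3` for EVERY run length `k`. [folklore] -/
theorem n22At_rateCarriers_of_kernels_pin_of_kernelStepRate_outputCoordHolo (𝔯 : RateReading₁₃CoPH N) (θ : Stage13HParams F N) (hP : θ.Provisos₁₃CoPH F N)
    (g₀ : ℕ → ℝ) (os : List (ULoop F)) (ℓ : U3Letters₁₁) (hs : ℓ.Signs) (hγ : 0 < θ.γ)
    (hpin : (𝔯.lit F θ hP g₀ os).u3 = objectsOfRecord₁₃ F N θ.toStage13Params ℓ)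
    (hlim : PolLimitsExistOfRecord₁₃ F N θ.toStage13Params) {κ₅ κd C₅ E₀ : ℝ} (hC₅ : 0 ≤ C₅) (hE₀ : 0 ≤ E₀)
    (h5 : KernelStepRateOfRecord₁₃ F N θ.toStage13Params κ₅ ℓ.θ₅ C₅)
    (hdec : DecayBound ((objectsOfRecord₁₃ F N θ.toStage13Params ℓ).EA 0) (Window θ.γ) E₀ κd)
    (m' : ℕ) (M : ℕ) [NeZero M] (hM : M = F.L ^ m')
    (S : (K : ℕ) → ClusterTower (F.P K) 𝔸 M) (emb : ReadingMaps F (MatA N) 𝔸) (hloc : Localizes17OfRecord₁₃ F N θ.toStage13Params S emb)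
    (sp : (K k : ℕ) → (domSys (F.P K) M (k + 1)).Dom → Set (CPair (F.P K) 𝔸))
    {κ κE δ₀ B₃ r B ρ₀ : ℝ} (hρ₀ : 0 < ρ₀)
    (hκ₀ : kappa₀ (4 * 2 ^ 4) (2 * 4) ≤ κ / 2) (hδ₀ : 0 < δ₀) (hB₃ : 0 ≤ B₃) (hr : 0 < r) (hB : 0 ≤ B) (hκE : κ ≤ κE)
    (hL : ∀ (K k : ℕ) (i : Fin (k + 1)), ∀ g ∈ box θ.γ k, ∀ (X : (domSys (F.P K) M (k + 1)).Dom), ∀ φ ∈ sp K k X,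
      ∃ (Ec : ℂ → ℂ) (O : Set ℂ), DifferentiableOn ℂ Ec O ∧ (∀ t ∈ Ioc (0 : ℝ) θ.γ, closedBall (t : ℂ) ρ₀ ⊆ O) ∧
        (∀ z ∈ O, ‖Ec z‖ ≤ B * Real.exp (-(κE * (domSys (F.P K) M (k + 1)).dj X))) ∧
        (∀ t ∈ Ioc (0 : ℝ) θ.γ, Ec t = ((S K) k).E (Function.update g i t) φ X))
    (Ec : ℕ → ℕ → Type*) [∀ K k, NormedAddCommGroup (Ec K k)] [∀ K k, NormedSpace ℂ (Ec K k)]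
    (ι : letI := θ.instVβ₁; letI := θ.instVβ₂
      (K k : ℕ) → (domSys (F.P K) M (k + 1)).Dom → ((Fin (F.P K).d → Site (F.P K) (k + 1) → θ.Vβ) →L[ℝ] Ec K k))
    (Φ : (K k : ℕ) → (domSys (F.P K) M (k + 1)).Dom → Ec K k → CPair (F.P K) 𝔸)
    (U : (K k : ℕ) → (domSys (F.P K) M (k + 1)).Dom → Set (Ec K k)) (hU : ∀ K k X, IsOpen (U K k X)) (hrU : ∀ K k X, ball (0 : Ec K k) r ⊆ U K k X)
    (hEhol : ∀ g ∈ Window θ.γ, ∀ (K k : ℕ) (X : (domSys (F.P K) M (k + 1)).Dom),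
      DifferentiableOn ℂ (fun z => ((S K) k).E (histPrefix g k) (Φ K k X z) X) (U K k X))
    (hΦemb : letI := θ.instVβ₁; letI := θ.instVβ₂
      ∀ (K k : ℕ) (X : (domSys (F.P K) M (k + 1)).Dom) (Bf : Fin (F.P K).d → Site (F.P K) (k + 1) → θ.Vβ),
        Φ K k X (ι K k X Bf) = emb K k (fun l t => NormedSpace.exp (θ.ρ8 (Bf l t))))
    (hΦsp : ∀ (K k : ℕ) (X : (domSys (F.P K) M (k + 1)).Dom), ∀ z ∈ ball (0 : Ec K k) r, Φ K k X z ∈ sp K k X)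
    (w : (K k : ℕ) → (domSys (F.P K) M (k + 1)).Dom → Site (F.P K) (k + 1) → ℝ) (hw₀ : ∀ K k X t, 0 ≤ w K k X t)
    (hw : letI := θ.instVβ₁; letI := θ.instVβ₂; letI := θ.instιβ
      ∀ (K k : ℕ) (X : (domSys (F.P K) M (k + 1)).Dom) (l : Fin (F.P K).d) (t : Site (F.P K) (k + 1)) (c : θ.ιβ),
        ‖ι K k X (Pi.single l (Pi.single t (θ.bV c)))‖ ≤ w K k X t)
    (htail : ∀ (K k : ℕ) (X : (domSys (F.P K) M (k + 1)).Dom) (t : Site (F.P K) (k + 1)),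
      let e : Site (F.P K) (k + 1) → TPt 4 (domCount (F.P K) M (k + 1) * M) := fun x i => (ZMod.cast (x i) : ZMod (domCount (F.P K) M (k + 1) * M))
      w K k X t ≤ B₃ * Real.exp (-δ₀ * distCT (domCount (F.P K) M (k + 1)) M (e t) (nearT (M := M) (e t) X)))
    (hκ₅ : delta1 δ₀ κ ((M : ℝ) * 4) ≤ κ₅) (hκd : delta1 δ₀ κ ((M : ℝ) * 4) ≤ κd)
    (hω : 0 < ℓ.ω) (hθω : ℓ.θ₅ ≤ ℓ.ω ^ 2) (hℓκ : ℓ.κ ≤ delta1 δ₀ κ ((M : ℝ) * 4))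
    (hC₉ : (4 * (2 * C₅ / (1 - ℓ.θ₅) + 2 * E₀) / θ.γ +
        ((16 * (64 * B / ρ₀ ^ 2) * B₃ ^ 2 / r ^ 2) * Real.exp (delta1 δ₀ κ ((M : ℝ) * 4) * ((M : ℝ) * 4) * 3) * K₀ (4 * 2 ^ 4) (2 * 4) *
          K₁ 4 (δ₀ / 2)) * θ.γ / 2) / ℓ.ω ≤ ℓ.C₉) (k : ℕ) :
    N22At (rateCarriersOfRecord₁₃CoPH 𝔯 F θ hP g₀ os k).u3 :=
  n22At_rateCarriers_of_kernels_pin_of_ne9 𝔯 θ hP g₀ os ℓ hs hpin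
    (ne9_EA_objectsOfRecord₁₃_of_kernelStepRate_outputCoordHolo F N θ.toStage13Params ℓ hs hγ hlim hC₅ hE₀ h5 hdec m' M hM S emb hloc sp hρ₀ hκ₀ hδ₀ hB₃ hr hB hκE hL
      Ec ι Φ U hU hrU hEhol hΦemb hΦsp w hw₀ hw htail hκ₅ hκd hω hθω hℓκ hC₉) k

open Classical in
/-- ★★★ **`h9` WITH THE RECORD's GEOMETRIC MODULI FROM NODE N18's LETTER + THE OUTPUT-LEVEL MARGIN DATUM ALONE** (§2 with the uniform decay DISCHARGED by §1a from the same `hL`): node N18's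
`KernelStepRateOfRecord₁₃ F N θ κ₅ ℓ.θ₅ C₅` + `hL` (ONE radius `ρ₀`) + the readings of record + tails + W1-20's law + (1.21) + rows `δ₁ ≤ κ₅`, `0 < ℓ.ω`, `ℓ.θ₅ ≤ ℓ.ω²`, `ℓ.κ ≤ δ₁`,
`(4·(2C₅∕(1−ℓ.θ₅) + 2E₁)∕θ.γ + C₂·θ.γ∕2)∕ℓ.ω ≤ ℓ.C₉` ⟹ **`NE9 ((objectsOfRecord₁₃ F N θ ℓ).EA 0) (Window θ.γ) ℓ.κ ℓ.moduli`**.  THE N22 ROW SENTENCE, shortest form in this lane: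
«N18's kernel step rate + output-level coupling margins with ONE radius + readings∕tails∕law∕(1.21) + rows ⇒ v5 §2b `h9` with the record's geometric moduli». [folklore] -/
theorem ne9_EA_objectsOfRecord₁₃_of_kernelStepRate_outputCoordHolo' (θ : Stage13Params F N) (ℓ : U3Letters₁₁) (hs : ℓ.Signs) (hγ : 0 < θ.γ)
    (hlim : PolLimitsExistOfRecord₁₃ F N θ) {κ₅ C₅ : ℝ} (hC₅ : 0 ≤ C₅)
    (h5 : KernelStepRateOfRecord₁₃ F N θ κ₅ ℓ.θ₅ C₅)
    (m' : ℕ) (M : ℕ) [NeZero M] (hM : M = F.L ^ m')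
    (S : (K : ℕ) → ClusterTower (F.P K) 𝔸 M) (emb : ReadingMaps F (MatA N) 𝔸) (hloc : Localizes17OfRecord₁₃ F N θ S emb)
    (sp : (K k : ℕ) → (domSys (F.P K) M (k + 1)).Dom → Set (CPair (F.P K) 𝔸))
    {κ κE δ₀ B₃ r B ρ₀ : ℝ} (hρ₀ : 0 < ρ₀)
    (hκ₀ : kappa₀ (4 * 2 ^ 4) (2 * 4) ≤ κ / 2) (hδ₀ : 0 < δ₀) (hB₃ : 0 ≤ B₃) (hr : 0 < r) (hB : 0 ≤ B) (hκE : κ ≤ κE)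
    (hL : ∀ (K k : ℕ) (i : Fin (k + 1)), ∀ g ∈ box θ.γ k, ∀ (X : (domSys (F.P K) M (k + 1)).Dom), ∀ φ ∈ sp K k X,
      ∃ (Ec : ℂ → ℂ) (O : Set ℂ), DifferentiableOn ℂ Ec O ∧ (∀ t ∈ Ioc (0 : ℝ) θ.γ, closedBall (t : ℂ) ρ₀ ⊆ O) ∧
        (∀ z ∈ O, ‖Ec z‖ ≤ B * Real.exp (-(κE * (domSys (F.P K) M (k + 1)).dj X))) ∧
        (∀ t ∈ Ioc (0 : ℝ) θ.γ, Ec t = ((S K) k).E (Function.update g i t) φ X))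
    (Ec : ℕ → ℕ → Type*) [∀ K k, NormedAddCommGroup (Ec K k)] [∀ K k, NormedSpace ℂ (Ec K k)]
    (ι : letI := θ.instVβ₁; letI := θ.instVβ₂
      (K k : ℕ) → (domSys (F.P K) M (k + 1)).Dom → ((Fin (F.P K).d → Site (F.P K) (k + 1) → θ.Vβ) →L[ℝ] Ec K k))
    (Φ : (K k : ℕ) → (domSys (F.P K) M (k + 1)).Dom → Ec K k → CPair (F.P K) 𝔸)
    (U : (K k : ℕ) → (domSys (F.P K) M (k + 1)).Dom → Set (Ec K k)) (hU : ∀ K k X, IsOpen (U K k X)) (hrU : ∀ K k X, ball (0 : Ec K k) r ⊆ U K k X)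
    (hEhol : ∀ g ∈ Window θ.γ, ∀ (K k : ℕ) (X : (domSys (F.P K) M (k + 1)).Dom),
      DifferentiableOn ℂ (fun z => ((S K) k).E (histPrefix g k) (Φ K k X z) X) (U K k X))
    (hΦemb : letI := θ.instVβ₁; letI := θ.instVβ₂
      ∀ (K k : ℕ) (X : (domSys (F.P K) M (k + 1)).Dom) (Bf : Fin (F.P K).d → Site (F.P K) (k + 1) → θ.Vβ),
        Φ K k X (ι K k X Bf) = emb K k (fun l t => NormedSpace.exp (θ.ρ8 (Bf l t))))
    (hΦsp : ∀ (K k : ℕ) (X : (domSys (F.P K) M (k + 1)).Dom), ∀ z ∈ ball (0 : Ec K k) r, Φ K k X z ∈ sp K k X)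
    (w : (K k : ℕ) → (domSys (F.P K) M (k + 1)).Dom → Site (F.P K) (k + 1) → ℝ) (hw₀ : ∀ K k X t, 0 ≤ w K k X t)
    (hw : letI := θ.instVβ₁; letI := θ.instVβ₂; letI := θ.instιβ
      ∀ (K k : ℕ) (X : (domSys (F.P K) M (k + 1)).Dom) (l : Fin (F.P K).d) (t : Site (F.P K) (k + 1)) (c : θ.ιβ),
        ‖ι K k X (Pi.single l (Pi.single t (θ.bV c)))‖ ≤ w K k X t)
    (htail : ∀ (K k : ℕ) (X : (domSys (F.P K) M (k + 1)).Dom) (t : Site (F.P K) (k + 1)),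
      let e : Site (F.P K) (k + 1) → TPt 4 (domCount (F.P K) M (k + 1) * M) := fun x i => (ZMod.cast (x i) : ZMod (domCount (F.P K) M (k + 1) * M))
      w K k X t ≤ B₃ * Real.exp (-δ₀ * distCT (domCount (F.P K) M (k + 1)) M (e t) (nearT (M := M) (e t) X)))
    (hκ₅ : delta1 δ₀ κ ((M : ℝ) * 4) ≤ κ₅) (hω : 0 < ℓ.ω) (hθω : ℓ.θ₅ ≤ ℓ.ω ^ 2) (hℓκ : ℓ.κ ≤ delta1 δ₀ κ ((M : ℝ) * 4))
    (hC₉ : (4 * (2 * C₅ / (1 - ℓ.θ₅) +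
        2 * ((16 * B * B₃ ^ 2 / r ^ 2) * Real.exp (delta1 δ₀ κ ((M : ℝ) * 4) * ((M : ℝ) * 4) * 3) * K₀ (4 * 2 ^ 4) (2 * 4) * K₁ 4 (δ₀ / 2))) / θ.γ +
        ((16 * (64 * B / ρ₀ ^ 2) * B₃ ^ 2 / r ^ 2) * Real.exp (delta1 δ₀ κ ((M : ℝ) * 4) * ((M : ℝ) * 4) * 3) * K₀ (4 * 2 ^ 4) (2 * 4) *
          K₁ 4 (δ₀ / 2)) * θ.γ / 2) / ℓ.ω ≤ ℓ.C₉) :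
    NE9 ((objectsOfRecord₁₃ F N θ ℓ).EA 0) (Window θ.γ) ℓ.κ ℓ.moduli :=
  have hE₁ : (0 : ℝ) ≤ (16 * B * B₃ ^ 2 / r ^ 2) * Real.exp (delta1 δ₀ κ ((M : ℝ) * 4) * ((M : ℝ) * 4) * 3) * K₀ (4 * 2 ^ 4) (2 * 4) * K₁ 4 (δ₀ / 2) := by
    have := K₀_pos (4 * 2 ^ 4) (2 * 4); have := K₁_nonneg 4 (δ₀ / 2); positivity
  ne9_EA_objectsOfRecord₁₃_of_kernelStepRate_outputCoordHolo F N θ ℓ hs hγ hlim hC₅ hE₁ h5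
    (decayBound_objectsOfRecord₁₃_of_outputCoordHolo F N θ ℓ hlim m' M hM S emb hloc sp hρ₀ hκ₀ hδ₀ hB₃ hr hB hκE hL Ec ι Φ U hU hrU hEhol hΦemb hΦsp w hw₀ hw htail)
    m' M hM S emb hloc sp hρ₀ hκ₀ hδ₀ hB₃ hr hB hκE hL Ec ι Φ U hU hrU hEhol hΦemb hΦsp w hw₀ hw htail hκ₅ le_rfl hω hθω hℓκ hC₉

end Record

end YMDAG.N22.KernelFading

end
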